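import Literature.NumberTheory.Automorphic.SupercuspidalCoefficientTrace
import Literature.NumberTheory.Automorphic.UnitaryGroupUnimodularAllRanks
import Literature.NumberTheory.Automorphic.CMPrincipalSeriesJacquetEvalOne
import Summits.HodgeConjecture.HodgeConjecture.Theorems.F0P3bSupercuspidalUnitarizable
import Summits.HodgeConjecture.HodgeConjecture.Theorems.F0P3LocalIrrepAdmissibleOfCuspidal
import Summits.HodgeConjecture.HodgeConjecture.Theorems.F0P3LocalIrrepAdmissibleThree
import Summits.HodgeConjecture.HodgeConjecture.Theorems.F0P3cStCharTSParField
import HarnessLib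

/-!
# E2-5a «SC-TRACE-PACKAGE @ `U(Φ₃)(L⁺_v)`» — the supercuspidal pseudo-coefficient CANDIDATE and its traces
(census «HC-SC» v1.1 (F0P3a-p02 g26) §2 E2-5, half (a); helper on crux H413 = stmt-HodgeConjecture-24833, supports-only;
THEOREMS ONLY — no definition, instance, notation, named fact, organ text or rider)

Let `v` be a NON-SPLIT finite place of the CM field `L`, `G = Gqs L v = U(Φ₃)(L⁺_v)`, `νQv` ANY Haar measure on `G`, and
`r : SmoothIrrep G` a SUPERCUSPIDAL irreducible smooth representation (★ `IrrClass.IsSupercuspidal`).  Rogawski 1990,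
§12.6 p. 187: «The existence of pseudo-coefficients follows from [K], Theorem 4.1 … `f_π` a matrix coefficient if `π` is
supercuspidal»; p. 188: «If `π` is supercuspidal, then `⟨χ_π, χ_π⟩ = 1` by [H₄], Theorem 17».  This file assembles, AT
`G`, the half of the supercuspidal pseudo-coefficient package that needs only the Schur orthogonality relations
(★ `SchurOrthogonalitySupercuspidal`, E2-1) and the coefficient trace identities (★ `SupercuspidalCoefficientTrace`, E2-2):
for an invariant positive-definite Hermitian form `B` on `r.V` and `v₁ ≠ 0`, the NORMALISED DIAGONAL COEFFICIENT
`f_{v₁} := ((∫ ‖B (r.ρ x v₁) v₁‖² dνQv) / re B v₁ v₁)⁻¹ • (g ↦ B (r.ρ g v₁) v₁)` (`= d(π) ‖v₁‖⁻² · u_{v₁}`, ★ E2-2's `f_v`)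
satisfies
* `f_{v₁} ∈ SchwartzBruhat G` (`C_c^∞(G)`: compact centre ★ `isCompact_center_Gqs`),
* `f_{v₁}(1) = d(π) = (re B v₁ v₁)² / ∫ ‖B (r.ρ x v₁) v₁‖²`, a POSITIVE REAL (`0 < re`, `im = 0`) — the POS-ONE letter,
* `tr π(f_{v₁}) = 1` for `π = IrrClass.mk r` (★ E2-2 (T1c)),
* `tr σ(f_{v₁}) = 0` for EVERY class `σ : IrrClass G` with `σ ≠ IrrClass.mk r` (★ E2-2 (T1b′) + Schur for intertwiners; every
  class of `G` is admissible, ★ `isAdmissible_irrClass_quasiSplit_of_cuspidal` + Harish-Chandra's criterion ★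
  `isSupercuspidal_of_subsingleton_coinvariants`),
with the representative data `(r, B, v₁)` EXPOSED as binders (E2-5b «SC-PSEUDO-COEFF @ datum» (F0P3a-p02) feeds the SAME
`B, v₁` to the Selberg (S4) and elliptic-reading (D) heads and adds the two `IsPseudoCoeff` orbital-integral clauses), and the
once-threaded PACKAGE facts: `NonarchimedeanGroup G` (★ `nonarchimedeanGroup_cmLocal`), `νQv.IsInvInvariant` (★
`isInvInvariant_cmDatum_local_of_three_le`, unimodularity), `r.ρ.IsAdmissible`, the existence of `B` (★
`isUnitarizable_of_isSupercuspidal_of_isCompact_center`).  The class-level existential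
`∀ π : IrrClass G, π.IsSupercuspidal → ∃ f ∈ SchwartzBruhat G, 0 < re (f 1) ∧ im (f 1) = 0 ∧ tr π(f) = 1 ∧ ∀ σ ≠ π, tr σ(f) = 0`
is `exists_scTraceCoeff`.  Count-neutral: no node of the (S-𝔇) block closes here.

References: Rogawski 1990 §12.6 pp. 187–188 [Rogawski1990]; Harish-Chandra 1970 Part I §1 Thm 1, Part III [HarishChandra1970].
-/

set_option autoImplicit false
-- the mandated namespace has the single-problem summit's repeated segment (`HodgeConjecture.HodgeConjecture`)
set_option linter.dupNamespace false

noncomputable section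

open NumberField IsDedekindDomain MeasureTheory
open scoped Matrix ComplexConjugate
open Literature.NumberTheory Literature.NumberTheory.Automorphic Literature.NumberTheory.Automorphic.UnitaryGroup
open Literature.NumberTheory.GaloisRepresentations
open Literature.NumberTheory.Rogawski1990

namespace Summit.HodgeConjecture.HodgeConjecture.Cruxes.H413.F0P3cStCharTSScTracePackage

open Summit.HodgeConjecture.HodgeConjecture.Cruxes.H413

variable (L : Type) [Field L] [NumberField L] [IsCMField L]

/-! ## §0 The package facts at `G = U(Φ₃)(L⁺_v)`, threaded once -/

/-- `U(Φ₃)(L⁺_v)` is a non-archimedean group (★ `nonarchimedeanGroup_cmLocal` on the `Gqs` spelling). [cite: PlatonovRapinchuk1994, §3.3] -/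
theorem nonarchimedeanGroup_Gqs (v : HeightOneSpectrum (𝓞 ↥(maximalRealSubfield L))) : NonarchimedeanGroup (Gqs L v) :=
  nonarchimedeanGroup_cmLocal L 3 v

/-- Every Haar measure on `U(Φ₃)(L⁺_v)` is inversion invariant (unimodularity, ★ `isInvInvariant_cmDatum_local_of_three_le`).
[cite: PlatonovRapinchuk1994, §3.5] -/
theorem isInvInvariant_haar_Gqs (v : HeightOneSpectrum (𝓞 ↥(maximalRealSubfield L)))
    [MeasurableSpace (Gqs L v)] [BorelSpace (Gqs L v)] (νQv : Measure (Gqs L v)) [νQv.IsHaarMeasure] :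
    νQv.IsInvInvariant :=
  isInvInvariant_cmDatum_local_of_three_le L (le_refl 3) (qsForm L) (antidiagOne_isHermitian L 3)
    (isUnit_antidiagOne_det L 3).ne_zero v νQv

/-- At a non-split place every irreducible smooth representation of `U(Φ₃)(L⁺_v)` is admissible (★
`isAdmissible_irrClass_quasiSplit_of_cuspidal` with Harish-Chandra's criterion ★ `isSupercuspidal_of_subsingleton_coinvariants`).
[cite: BernsteinZelevinsky1977, Prop. 1.9 (b), Thm. 2.4 (a)] -/
theorem isAdmissible_smoothIrrep (v : HeightOneSpectrum (𝓞 ↥(maximalRealSubfield L)))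
    (hns : ∀ w : PlacesOver L v, IsCMField.complexConj L • w.1 = w.1) (r : SmoothIrrep (Gqs L v)) : r.ρ.IsAdmissible :=
  (IrrClass.isAdmissible_mk r).1
    (F0P3LocalIrrepAdmissibleOfCuspidal.isAdmissible_irrClass_quasiSplit_of_cuspidal L v
      (F0P3LocalIrrepAdmissibleThree.isSupercuspidal_of_subsingleton_coinvariants L v hns) (IrrClass.mk r))

/-- A supercuspidal `r : SmoothIrrep (U(Φ₃)(L⁺_v))` (non-split `v`) carries a `G`-invariant positive-definite Hermitian form (★
`isUnitarizable_of_isSupercuspidal_of_isCompact_center`, compact centre ★ `isCompact_center_Gqs`; Rogawski 1990 §12.2 p. 173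
«unitary since the centre … is compact»). [cite: Rogawski1990, §12.2 p. 173] -/
theorem exists_invariantForm_of_isSupercuspidal (v : HeightOneSpectrum (𝓞 ↥(maximalRealSubfield L)))
    (hns : ∀ w : PlacesOver L v, IsCMField.complexConj L • w.1 = w.1)
    (r : SmoothIrrep (Gqs L v)) (hr : (IrrClass.mk r).IsSupercuspidal) :
    ∃ B : r.V →ₗ⋆[ℂ] r.V →ₗ[ℂ] ℂ, B.IsSymm ∧ (∀ w : r.V, w ≠ 0 → 0 < (B w w).re) ∧
      ∀ (g : Gqs L v) (w w' : r.V), B (r.ρ g w) (r.ρ g w') = B w w' := by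
  haveI : NonarchimedeanGroup (Gqs L v) := nonarchimedeanGroup_Gqs L v
  obtain ⟨K₀, hK₀c⟩ := exists_isCompact_openSubgroup (G := Gqs L v)
  exact r.ρ.isUnitarizable_of_isSupercuspidal_of_isCompact_center r.isSmooth K₀.isOpen hK₀c
    ((IrrClass.isSupercuspidal_mk r).1 hr) (F0P3cStCharTSParField.isCompact_center_Gqs L v hns)

/-! ## §1 The normalised coefficient `f_{v₁}` of a supercuspidal representative: test function, value at `1`, traces -/

section Coefficient

variable (v : HeightOneSpectrum (𝓞 ↥(maximalRealSubfield L)))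
  (hns : ∀ w : PlacesOver L v, IsCMField.complexConj L • w.1 = w.1)
  [MeasurableSpace (Gqs L v)] [BorelSpace (Gqs L v)] (νQv : Measure (Gqs L v)) [νQv.IsHaarMeasure]
  (r : SmoothIrrep (Gqs L v)) (hr : (IrrClass.mk r).IsSupercuspidal)
  (B : r.V →ₗ⋆[ℂ] r.V →ₗ[ℂ] ℂ) (hBsymm : B.IsSymm) (hBpos : ∀ w : r.V, w ≠ 0 → 0 < (B w w).re)
  (hBinv : ∀ (g : Gqs L v) (w w' : r.V), B (r.ρ g w) (r.ρ g w') = B w w')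

omit [MeasurableSpace (Gqs L v)] [BorelSpace (Gqs L v)] in
include hns hr hBinv in
/-- The diagonal coefficient `u_{v₁}(g) = B (r.ρ g v₁) v₁` of a supercuspidal representative is a TEST FUNCTION on `U(Φ₃)(L⁺_v)`
(`C_c^∞`: ★ `IsSupercuspidal.mem_schwartzBruhat_sesqForm_apply_self`, compact centre). [cite: Rogawski1990, §12.6 p. 187] -/
theorem sesqForm_apply_self_mem_schwartzBruhat (v₁ : r.V) : (fun g => B (r.ρ g v₁) v₁) ∈ SchwartzBruhat (Gqs L v) := by
  haveI : NonarchimedeanGroup (Gqs L v) := nonarchimedeanGroup_Gqs L v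
  exact ((IrrClass.isSupercuspidal_mk r).1 hr).mem_schwartzBruhat_sesqForm_apply_self
    (F0P3cStCharTSParField.isCompact_center_Gqs L v hns) r.isSmooth hBinv v₁

omit [BorelSpace (Gqs L v)] [νQv.IsHaarMeasure] in
include hns hr hBinv in
/-- The normalised coefficient `f_{v₁} = ((∫ ‖B (r.ρ x v₁) v₁‖² dνQv) / re B v₁ v₁)⁻¹ • u_{v₁}` is a test function. [cite: Rogawski1990, §12.6 p. 187] -/
theorem scCoeff_mem_schwartzBruhat (v₁ : r.V) :
    ((((∫ x, ‖B (r.ρ x v₁) v₁‖ ^ 2 ∂νQv) / (B v₁ v₁).re : ℝ) : ℂ)⁻¹ • fun g => B (r.ρ g v₁) v₁) ∈ SchwartzBruhat (Gqs L v) :=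
  Submodule.smul_mem _ _ (sesqForm_apply_self_mem_schwartzBruhat L v hns r hr B hBinv v₁)

include hns hr hBsymm hBpos hBinv in
/-- **POS-ONE.** `f_{v₁}(1) = (re B v₁ v₁)² / ∫ ‖B (r.ρ x v₁) v₁‖² dνQv`, the FORMAL DEGREE of `r` relative to `νQv`, a positive
real number: `0 < re (f_{v₁} 1)` and `im (f_{v₁} 1) = 0` (★ E2-2 `inv_smul_sesqForm_apply_self_one`).
[cite: HarishChandra1970, Part I §1 Theorem 1 (a)] -/
theorem scCoeff_one_re_pos_im_zero {v₁ : r.V} (hv₁ : v₁ ≠ 0) :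
    0 < (((((∫ x, ‖B (r.ρ x v₁) v₁‖ ^ 2 ∂νQv) / (B v₁ v₁).re : ℝ) : ℂ)⁻¹ • fun g => B (r.ρ g v₁) v₁) 1).re ∧
      (((((∫ x, ‖B (r.ρ x v₁) v₁‖ ^ 2 ∂νQv) / (B v₁ v₁).re : ℝ) : ℂ)⁻¹ • fun g => B (r.ρ g v₁) v₁) 1).im = 0 := by
  haveI : NonarchimedeanGroup (Gqs L v) := nonarchimedeanGroup_Gqs L v
  obtain ⟨h1, hpos⟩ := ((IrrClass.isSupercuspidal_mk r).1 hr).inv_smul_sesqForm_apply_self_one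
    (F0P3cStCharTSParField.isCompact_center_Gqs L v hns) r.isSmooth hBsymm hBpos hBinv νQv hv₁
  rw [h1, Complex.ofReal_re, Complex.ofReal_im]
  exact ⟨hpos, rfl⟩

include hns hr hBsymm hBpos hBinv in
/-- **`tr π(f_{v₁}) = 1`** for `π = IrrClass.mk r` (★ E2-2 `smoothTrace_inv_smul_sesqForm_apply_self` through ★ `IrrClass.smoothTrace_mk`;
the package supplies admissibility and the inversion invariance of `νQv`). [cite: HarishChandra1970, Part I §1 Theorem 1 (a)] -/
theorem smoothTrace_mk_scCoeff {v₁ : r.V} (hv₁ : v₁ ≠ 0) :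
    (IrrClass.mk r).smoothTrace νQv
        ((((∫ x, ‖B (r.ρ x v₁) v₁‖ ^ 2 ∂νQv) / (B v₁ v₁).re : ℝ) : ℂ)⁻¹ • fun g => B (r.ρ g v₁) v₁) = 1 := by
  haveI : NonarchimedeanGroup (Gqs L v) := nonarchimedeanGroup_Gqs L v
  haveI : νQv.IsInvInvariant := isInvInvariant_haar_Gqs L v νQv
  rw [IrrClass.smoothTrace_mk]
  exact ((IrrClass.isSupercuspidal_mk r).1 hr).smoothTrace_inv_smul_sesqForm_apply_self
    (isAdmissible_smoothIrrep L v hns r) (F0P3cStCharTSParField.isCompact_center_Gqs L v hns) hBsymm hBpos hBinv νQv hv₁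

include hns hr hBsymm hBpos hBinv in
/-- **`tr σ(f_{v₁}) = 0` for every class `σ ≠ IrrClass.mk r`**: a representative `s` of `σ` admits no non-zero intertwiner
`s.ρ → r.ρ` (Schur: Mathlib `Subsingleton (IntertwiningMap …)` from `IsEmpty (s.ρ.Equiv r.ρ)`, ★ `IrrClass.mk_eq_mk_iff`), so ★ E2-2
`smoothTrace_inv_smul_sesqForm_apply_self_eq_zero_of_forall_intertwiningMap` applies (`s` admissible by the package).
[cite: HarishChandra1970, Part I §1 Theorem 1 (b)] -/
theorem smoothTrace_scCoeff_eq_zero_of_ne (v₁ : r.V) (σ : IrrClass (Gqs L v)) (hσ : σ ≠ IrrClass.mk r) :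
    σ.smoothTrace νQv
        ((((∫ x, ‖B (r.ρ x v₁) v₁‖ ^ 2 ∂νQv) / (B v₁ v₁).re : ℝ) : ℂ)⁻¹ • fun g => B (r.ρ g v₁) v₁) = 0 := by
  haveI : NonarchimedeanGroup (Gqs L v) := nonarchimedeanGroup_Gqs L v
  haveI : νQv.IsInvInvariant := isInvInvariant_haar_Gqs L v νQv
  induction σ using IrrClass.ind with
  | h s =>
    haveI : IsEmpty (s.ρ.Equiv r.ρ) := ⟨fun e => hσ (IrrClass.mk_eq_mk_of_equiv e)⟩
    rw [IrrClass.smoothTrace_mk]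
    exact ((IrrClass.isSupercuspidal_mk r).1 hr).smoothTrace_inv_smul_sesqForm_apply_self_eq_zero_of_forall_intertwiningMap
      (isAdmissible_smoothIrrep L v hns r) (F0P3cStCharTSParField.isCompact_center_Gqs L v hns) hBsymm hBpos hBinv
      (isAdmissible_smoothIrrep L v hns s) (fun T => Subsingleton.elim T 0) νQv v₁

end Coefficient

/-! ## §2 The class-level existential (census §2 E2-5 (P) without the two orbital-integral clauses) -/

/-- **E2-5a, PACKAGED.** At a non-split place `v`, for every SUPERCUSPIDAL class `π` of `U(Φ₃)(L⁺_v)` and every Haar measure `νQv`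
there is a test function `f ∈ C_c^∞(G)` with `f(1)` a positive real, `tr π(f) = 1` and `tr σ(f) = 0` for every class `σ ≠ π` —
the normalised diagonal coefficient of §1 for some invariant positive-definite Hermitian form and some non-zero vector of a
representative.  (The two `IsPseudoCoeff` clauses — vanishing off `G^e`, `conj χ_π` on `G^e` — are E2-5b's.)
[cite: Rogawski1990, §12.6 p. 187] -/
theorem exists_scTraceCoeff (v : HeightOneSpectrum (𝓞 ↥(maximalRealSubfield L)))
    (hns : ∀ w : PlacesOver L v, IsCMField.complexConj L • w.1 = w.1)
    [MeasurableSpace (Gqs L v)] [BorelSpace (Gqs L v)] (νQv : Measure (Gqs L v)) [νQv.IsHaarMeasure]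
    (π : IrrClass (Gqs L v)) (hπ : π.IsSupercuspidal) :
    ∃ f : Gqs L v → ℂ, f ∈ SchwartzBruhat (Gqs L v) ∧ 0 < (f 1).re ∧ (f 1).im = 0 ∧ π.smoothTrace νQv f = 1 ∧
      ∀ σ : IrrClass (Gqs L v), σ ≠ π → σ.smoothTrace νQv f = 0 := by
  induction π using IrrClass.ind with
  | h r =>
    obtain ⟨B, hBsymm, hBpos, hBinv⟩ := exists_invariantForm_of_isSupercuspidal L v hns r hπ
    haveI : Nontrivial r.V := Representation.IsIrreducible.nontrivial r.ρ
    obtain ⟨v₁, hv₁⟩ := exists_ne (0 : r.V)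
    obtain ⟨hre, him⟩ := scCoeff_one_re_pos_im_zero L v hns νQv r hπ B hBsymm hBpos hBinv hv₁
    exact ⟨_, scCoeff_mem_schwartzBruhat L v hns νQv r hπ B hBinv v₁, hre, him,
      smoothTrace_mk_scCoeff L v hns νQv r hπ B hBsymm hBpos hBinv hv₁,
      smoothTrace_scCoeff_eq_zero_of_ne L v hns νQv r hπ B hBsymm hBpos hBinv v₁⟩

end Summit.HodgeConjecture.HodgeConjecture.Cruxes.H413.F0P3cStCharTSScTracePackage
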